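import Summits.QuantumFields.BalabanUV.T4Continuum.Support.NE3CurlOfGaugeDir
import Summits.QuantumFields.BalabanUV.T4Continuum.Support.NE3HessBounds
import HarnessLib

/-!
# T⁴ programme, node NE3, route Π row Π-G0 — THE FIRST VARIATION OF THE WILSON ACTION VANISHES ON PURE GAUGE DIRECTIONS, EXACTLY:
# `dAction W (gaugeDir W ζ) F = 0` for EVERY units-valued `W`, EVERY site field `ζ`, EVERY window `F`

NE3 formalisation swarm `b2b-balaban-t4-ne3-formalise-*`, LEAF PROVER 04 (gen 6), row Π-G0 of the owner's design note `HOME/t4/b2b-balaban-t4-ne3-p1/g24/D-ne3p1-g24-1.md`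
§6 (ruling ρ-g24-2; «natural holder: leaf-04»).  In the endpoint chart of route Π (§3 of the note) the gauge part `G = gaugeDir W μ` of the tangent datum
meets the first variation only through `dA_W(G)`, which VANISHES — there labelled «gauge invariance, infinitesimal».  The kernel proof is plaquette-wise
ALGEBRA and needs NO unitarity, NO periodicity and NO smallness: by the row OWNER's K6-cg `NE3CurlOfGaugeDir.curlAt_gaugeDir` (p232170) the dressed
curl of a pure gauge direction is the plaquette commutator `ζ z − Ad_{W(∂p)} ζ z`, so the density of `NE3HessForm.dAction` at `p` is
`Re tr[(ζ − W(∂p) ζ W(∂p)⁻¹)·W(∂p)] = Re tr[ζ·W(∂p)] − Re tr[W(∂p)·ζ] = 0` by cyclicity of the trace (`NE3HessBounds.nReTr_mul_comm`).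

CONTENT (all [folklore]; 0 sorry; 0 def): `Ad_mul_val` (`Ad_U X · U = U · X`), `nReTr_curl_gaugeDir_mul_fhol` (the density vanishes on every plaquette),
**`dAction_gaugeDir : dAction W (gaugeDir W ζ) F = 0`**, and the affine corollary `dAction_add_gaugeDir : dAction W (Y + gaugeDir W ζ) F = dAction W Y F`.

HONEST FRAMING.  Elementary gauge calculus on OUR typed objects; nothing about Bałaban's minimisers; the endpoint chart, (P♮)_W, (ML_w) at W ≠ 1, T-E_w and
NE3 are NOT proved; spine PROVED 0∕9; finite T⁴ rung (B)+1 — NOT infinite volume, NOT mass gap, NOT BetaPertH, NOT Clay.  ABSOLUTE RULE kept (no printed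
sentence is a hypothesis; context only: gauge invariance of the Wilson action, [Balaban1985Variational] (5) p. 278).  PLACEMENT: `Summits/QuantumFields/BalabanUV/`.
HONEST DEPENDENCY: continuum YM on T⁴ ⇐ BetaPertH ∧ nine spine estimates (0/9 proved); BetaPertH ⇐ (D1) ∧ (D4) ∧ CAP+tail; G-an2-4 gates asym, D1 and NE2/3/4.
-/

set_option autoImplicit false

open scoped BigOperators Matrix.Norms.L2Operator
open Finset

namespace Summit.QuantumFields.BalabanUV.T4Continuum.NE3PureGaugeFirstVariation

open Literature.MathematicalPhysics.QuantumFieldTheory.Balaban1983to89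
open B7Prop1Explicit B7Prop2Explicit UnitaryModel
open T4AveragingDeficitWall (Ad curlAt curl fhol Plaq)
open BlockAveragePushDirGauge (gaugeDir)
open NE3CurlOfGaugeDir (curlAt_gaugeDir)
open NE3HessForm (dAction)
open NE3HessBounds (nReTr_mul_comm)

noncomputable section

variable {d : ℕ} {n : Type*} [Fintype n] [DecidableEq n]

/-- `Ad_U X · U = U · X` for a unit `U`. [folklore] -/
theorem Ad_mul_val (U : (Matrix n n ℂ)ˣ) (X : Matrix n n ℂ) : Ad U X * (U : Matrix n n ℂ) = (U : Matrix n n ℂ) * X := by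
  unfold Ad
  rw [mul_assoc, Units.inv_mul, mul_one]

/-- **THE FIRST-VARIATION DENSITY VANISHES ON A PURE GAUGE DIRECTION, ON EVERY PLAQUETTE**:
`Re tr[(d_W (gaugeDir W ζ))(p) · W(∂p)] = Re tr[ζ·W(∂p)] − Re tr[W(∂p)·ζ] = 0`. [folklore] -/
theorem nReTr_curl_gaugeDir_mul_fhol (W : Site d → Fin d → (Matrix n n ℂ)ˣ) (ζ : Site d → Matrix n n ℂ) (p : Plaq d) :
    nReTr (curl W (gaugeDir W ζ) p * ((fhol W p : (Matrix n n ℂ)ˣ) : Matrix n n ℂ)) = 0 := by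
  obtain ⟨z, ⟨⟨μ, ν⟩, hμν⟩⟩ := p
  show nReTr (curlAt W (gaugeDir W ζ) z μ ν * ((hol W z (plaqWord μ ν) : (Matrix n n ℂ)ˣ) : Matrix n n ℂ)) = 0
  rw [curlAt_gaugeDir, sub_mul, Ad_mul_val]
  unfold nReTr
  rw [Matrix.trace_sub, Matrix.trace_mul_comm, sub_self, Complex.zero_re, zero_div]

/-- **Π-G0 — THE FIRST VARIATION OF THE WILSON ACTION VANISHES ON PURE GAUGE DIRECTIONS**: for every units-valued `W`, every site field `ζ`
and every window `F`, `dAction W (gaugeDir W ζ) F = 0` (no unitarity, periodicity or smallness needed). [folklore] -/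
theorem dAction_gaugeDir (W : Site d → Fin d → (Matrix n n ℂ)ˣ) (ζ : Site d → Matrix n n ℂ) (F : Finset (Plaq d)) :
    dAction W (gaugeDir W ζ) F = 0 := by
  unfold dAction
  rw [Finset.sum_eq_zero fun p _ => nReTr_curl_gaugeDir_mul_fhol W ζ p, neg_zero]

/-- The dressed curl is additive in the direction field. [folklore] -/
theorem curl_add (W : Site d → Fin d → (Matrix n n ℂ)ˣ) (X Y : Site d → Fin d → Matrix n n ℂ) (p : Plaq d) :
    curl W (X + Y) p = curl W X p + curl W Y p := by
  obtain ⟨z, ⟨⟨μ, ν⟩, hμν⟩⟩ := p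
  show curlAt W (X + Y) z μ ν = curlAt W X z μ ν + curlAt W Y z μ ν
  simp only [curlAt, Pi.add_apply, AveragingDeficitNearIdentity.Ad_add]
  abel

/-- **AFFINE COROLLARY**: adding a pure gauge direction does not change the first variation: `dAction W (Y + gaugeDir W ζ) F = dAction W Y F` — in the
endpoint chart of route Π the gauge part of the tangent datum never meets the residual. [folklore] -/
theorem dAction_add_gaugeDir (W : Site d → Fin d → (Matrix n n ℂ)ˣ) (Y : Site d → Fin d → Matrix n n ℂ) (ζ : Site d → Matrix n n ℂ)
    (F : Finset (Plaq d)) : dAction W (Y + gaugeDir W ζ) F = dAction W Y F := by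
  unfold dAction
  rw [neg_inj]
  refine Finset.sum_congr rfl fun p _ => ?_
  have h0 := nReTr_curl_gaugeDir_mul_fhol W ζ p
  unfold nReTr at h0 ⊢
  rw [curl_add, add_mul, Matrix.trace_add, Complex.add_re, add_div, h0, add_zero]

end

end Summit.QuantumFields.BalabanUV.T4Continuum.NE3PureGaugeFirstVariation
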